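import Literature.AlgebraicGeometry.HodgeTheory.HodgeSectionRestriction
import Literature.AlgebraicGeometry.HodgeTheory.ClassesSupportedOn
import Literature.AlgebraicGeometry.HodgeTheory.AlgebraicClassesCup
import Literature.AlgebraicGeometry.Motives.ProjectiveDescentNormProofs
import Literature.AlgebraicGeometry.Motives.ComplexPointsManifold
import Literature.AlgebraicTopology.SingularHomology.CechTautness
import Literature.AlgebraicTopology.SingularHomology.CohomologyHomotopyInvariance
import Literature.Geometry.Manifold.TopologicalEmbedding
import HarnessLib

/-!
# Hodge classes restrict non-trivially to hypersurface sections: the printed proof of BFNP Lemma 50, reduced to its analytic inputs (proved reduction)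

Family `hodge`, layer `Literature/AlgebraicGeometry/HodgeTheory`. Companion of the named fact
`hodgeSectionRestriction_of_hodgeConjectureFor` (file `HodgeSectionRestriction`; P. Brosnan, H. Fang,
Z. Nie, G. Pearlstein, *Singularities of admissible normal functions*, Invent. Math. 177 (2009),
§6 Lemma 50 with Lemma 49, arXiv:0711.0964 p. 13). This file formalises THE PRINTED PROOF of
Lemma 50 on the tree's carriers (`complexBetti X k = Hᵏ(X(ℂ); ℂ)`, `IsRationalClass`,
`IsOfHodgeType`, `algebraicClasses X p = Nᵖ H²ᵖ(X(ℂ); ℂ)`, the Alexander–Whitney `cupProduct`),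
isolating as EXPLICIT HYPOTHESES of the reduction theorems the inputs of the proof that the tree
does not yet have. No new named fact is introduced (D-0026) and the named fact itself is untouched
(it is NOT discharged here).

The printed proof (verbatim, arXiv p. 13): "Let `ζ` be a non-zero class in `Hdg^{2n}(X)`. By
Poincaré duality and the Hodge–Riemann relations, there exists a class `α ∈ Hdg^{2n}(X)` such that
`0 ≠ α ∪ ζ ∈ Hdg^{4n}(X) ≅ ℚ(2n)`. By the Hodge conjecture for `X`, we can write `α = Σ aᵢ [Zᵢ]` for
`aᵢ ∈ ℚ` and `Zᵢ` closed subvarieties of `X`. Since `ζ ∪ α ≠ 0`, `ζ ∪ [Zᵢ] ≠ 0` for some index `i`.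
Equivalently, `0 ≠ ζ|_{Zᵢ} ∈ H^{2n}(Zᵢ, ℚ(n))`. The lemma then follows from Lemma 49." — and
Lemma 49: "Let `𝓛` be an ample line bundle on `X` and let `Z ⊂ X` be a closed subvariety. Then
there exists an integer `N` such that, for all `m ≥ N`, there exists a divisor `D ∈ |𝓛^m|` such
that `Z ⊂ D`."

## The steps on the tree's carriers

* (P) "By Poincaré duality and the Hodge–Riemann relations …": the cup product restricts to a
  perfect pairing `Hdg^n X ⊗ Hdg^n X → ℚ` on a `2n`-fold (BFNP §6, the display preceding Lemma 48).
  HYPOTHESIS `hPair`: for every non-zero rational `(n, n)`-class `c` there is a rational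
  `(n, n)`-class `a` with `c ∪ a ≠ 0 ∈ H^{4n}(X(ℂ); ℂ)`. In print this is the Lefschetz decomposition
  over `ℚ` (hard Lefschetz — the tree's unproved `nonempty_hardLefschetzNFold`) with the
  Hodge–Riemann bilinear relations (Voisin I, Thm. 6.32) for the cup product; the tree has it for
  SURFACES, as the named fact `hodgeIndex_surface` (with `lefschetzOneOne_rational`:
  `exists_cup_ne_zero_of_hodgeIndex`, file `HodgeIndexSurface`), which feeds the topological core
  below directly (a divisor class `d` with `c ∪ d ≠ 0`).
* (H) "`α = Σ aᵢ [Zᵢ]`": `a ∈ algebraicClasses X n = Σ_Z ker(H^{2n}(X(ℂ)) → H^{2n}((X ∖ Z)(ℂ)))`,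
  `Z` Zariski-closed of codimension `≥ n` (`HodgeConjectureFor`); the classes pairing to zero with
  `c` form a submodule, so it suffices to treat a class `a'` killed off one such `Z`
  (`supportedClasses_le`). PROVED.
* (C) "`ζ ∪ [Zᵢ] ≠ 0`, equivalently `ζ|_{Zᵢ} ≠ 0`": if `c` vanishes on an OPEN `V ⊇ Z(ℂ)` and `a'`
  vanishes on the open `(X ∖ Z)(ℂ)` then `c ∪ a' = 0` — the cup product with supports for the open
  cover `{V, (X ∖ Z)(ℂ)}` of `X(ℂ)` (Hatcher §3.2 p. 209; the tree's `map_cupProduct_eq_zero_of_isOpen`),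
  PROVED here as `cupProduct_eq_zero_of_isOpen_of_restrictCompl`. Passing from "`c|_{D(ℂ)} = 0`"
  for the CLOSED `D(ℂ)` to an open `V ⊇ D(ℂ)` is TAUTNESS of `D(ℂ)` in `X(ℂ)` for singular
  cohomology — HYPOTHESIS `hTaut` of the core theorem. It is PROVED here
  (`exists_isOpen_map_eq_zero_of_locallyContractibleSpace`) from the weaker-looking, standard
  input (LC) "`Z(ℂ)` is locally contractible" (complex algebraic sets are triangulable —
  Łojasiewicz 1964, Hironaka 1975 — hence locally contractible; not in the tree): `X(ℂ)` is a
  compact topological manifold (GAGA charts, `IsSmoothProjective.chartedSpace`), so it embeds in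
  some `ℝᴺ` as a neighbourhood retract (`exists_isClosedEmbedding_pi_of_compactSpace`, Hatcher
  Cor. A.9 with the tree's PROVED Thm. A.7 `isNeighbourhoodRetract_of_locallyContractibleSpace_holds`),
  and a compact locally contractible `Z(ℂ)` then carries a tautness datum
  (`Cech.RetractionNhds.nonempty_of_locallyContractibleSpace`, Spanier Thm. 6.1.10 / Cor. 6.1.11,
  proved in the tree), which with homotopy invariance (`singularCohomology.map_eq_of_homotopic'`)
  extends the vanishing of `c` from `Z(ℂ)` to an open neighbourhood.
* (L49) "`Zᵢ ⊂ D`, `D ∈ |𝓛^m|`" in the hypersurface-section rendering of the fact: a Zariski-closed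
  `Z ⊆ X` missing a point `x` lies in `e⁻¹ V₊(F)` for an ambient form `F` of degree `k ≥ 1` not
  vanishing at `e(x)` — graded prime avoidance for the homogeneous vanishing ideal of the closed set
  `e(Z) ⊆ ℙᴺ` (the tree's `Motives.GradedPrimeAvoidance.exists_posHomog_notMem_point`). PROVED here
  (`exists_form_vanishing_of_notMem`), together with: a closed `Z` all of whose points have
  codimension `≥ 1` misses the generic point of the irreducible `X` (`exists_notMem_of_coheight`).

Results: `exists_sectionRestriction_ne_zero_of_cup_ne_zero` — the topological core (a class `c`
pairing non-trivially with SOME algebraic class restricts non-trivially to some hypersurface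
section, granted (T); any dimension, no Hodge theory); `exists_sectionRestriction_ne_zero_of_pairing_of_taut`
— Lemma 50 for one `2n`-fold from (P), (T) and the Hodge conjecture for it;
`hodgeSectionRestriction_of_hodgeConjectureFor_of_pairing_of_taut` — the named fact from (P) and
(T) quantified over all smooth projective `2n`-folds; and the same three with (LC) in place of (T):
`exists_sectionRestriction_ne_zero_of_cup_ne_zero_of_locallyContractible`,
`exists_sectionRestriction_ne_zero_of_pairing_of_locallyContractible`,
`hodgeSectionRestriction_of_hodgeConjectureFor_of_pairing_of_locallyContractible` — so that the
named fact is reduced to exactly two classical inputs absent from the tree: (P) the perfect pairing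
on middle Hodge classes and (LC) the local contractibility of complex algebraic sets.

Support form (section "Support form of the printed proof", added 2026-08-15): the printed order
"`0 ≠ ζ|_{Zᵢ}` … then follows from Lemma 49" is formalised literally —
`forall_le_exists_sectionRestriction_ne_zero_of_supportCriterion` derives the conclusion, for
EVERY degree `k ≥ k₀` (the strength in which the proof of Thm. 51 uses Lemma 50; Lemma 49 in
all large degrees is `exists_forall_le_form_vanishing_of_notMem`), from a SUPPORT CRITERION
("`c ∪ a ≠ 0`, `a` supported on `Z` ⟹ `c|_{Z(ℂ)} ≠ 0`") plus functoriality of restriction along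
`Zᵢ ⊆ D` (`map_ne_zero_of_subset`); the criterion follows from tautness of the SUPPORTS only
(`map_ne_zero_of_cupProduct_ne_zero_of_taut`), whence
`hodgeSectionRestriction_of_hodgeConjectureFor_of_pairing_of_tautSupports` /
`…_of_pairing_of_locallyContractibleSupports` ((T)/(LC) required only for the Zariski-closed
subsets of codimension `≥ n`), and — without any tautness — from Deligne's Gysin-kernel theorem,
resolutions and the projection formula (file `HodgeSectionRestrictionGysinKernel`).

## What is NOT here

The hypotheses themselves (so the named fact is NOT discharged by this file): (P) needs, on these
carriers, the complex orientation of `X(ℂ)` and `H^{4n}(X(ℂ); ℂ) ≅ ℂ`, hard Lefschetz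
(`nonempty_hardLefschetzNFold`, unproved), the Lefschetz decomposition over `ℚ` and the
Hodge–Riemann bilinear relations for the cup product transported along the de Rham comparison of
a Hodge model; (LC) is the local contractibility of complex algebraic sets (local conic
structure / triangulability: Łojasiewicz 1964, Hironaka 1975), of which the tree has only the
manifold case (`locallyContractibleSpace_of_chartedSpace`). Neither is vendored as a
`def … : Prop` (D-0026).

## References

* [BrosnanFangNiePearlstein2009] P. Brosnan, H. Fang, Z. Nie, G. Pearlstein, Singularities of
  admissible normal functions, Invent. Math. 177 (2009) 599–629, §6: display before Lemma 48,
  Lemma 49, Lemma 50 (arXiv:0711.0964, p. 13).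
* [VoisinHodgeI2002] C. Voisin, Hodge Theory and Complex Algebraic Geometry I (CUP 2002), §6.3.2
  Thm. 6.32 (Hodge–Riemann bilinear relations), §6.2.3 (Lefschetz decomposition).
* [HatcherAT2002] A. Hatcher, Algebraic Topology (CUP 2002), §3.1 p. 201 (homotopy invariance),
  §3.2 p. 209 (relative cup product), Appendix Thm. A.7 and Cor. A.9 (Euclidean neighbourhood
  retracts).
* [Spanier1981] E. H. Spanier, Algebraic Topology (Springer 1981), Ch. 6 §1, Thm. 10 and Cor. 11
  (tautness of neighbourhood retracts).
-/

noncomputable section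

open CategoryTheory AlgebraicGeometry
open Literature.AlgebraicTopology.SingularHomology Literature.AlgebraicTopology.Homotopy

namespace Literature.AlgebraicGeometry.HodgeTheory

section HodgeTheory

universe u

/-! ### (L49) Forms through a closed subset missing a point -/

/-- **Graded prime avoidance, closed-embedding form**: for a closed embedding `f : Y → Proj A`,
a closed `Z ⊆ Y` and a point `x ∉ Z`, there is a homogeneous `F ∈ A` of positive degree
vanishing on `f(Z)` (i.e. `F ∈ 𝔭_{f z}` for all `z ∈ Z`) and not at `f x`: the homogeneous
vanishing ideal of the closed set `f(Z)` is not contained in the relevant prime `𝔭_{f x}`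
(`f x ∉ f(Z) = V₊(I(f(Z)))`), so it contains a positive-degree homogeneous element outside it
(`Motives.GradedPrimeAvoidance.exists_posHomog_notMem_point`). [folklore] -/
theorem exists_homogeneous_mem_forall_notMem {Y : Type*} [TopologicalSpace Y]
    {A : Type u} {σ : Type*} [CommRing A] [SetLike σ A] [AddSubgroupClass σ A]
    (𝒜 : ℕ → σ) [GradedRing 𝒜] {f : Y → ProjectiveSpectrum 𝒜} (hf : Topology.IsClosedEmbedding f)
    {Z : Set Y} (hZ : IsClosed Z) {x : Y} (hx : x ∉ Z) :
    ∃ (k : ℕ) (F : A), 0 < k ∧ F ∈ 𝒜 k ∧ (∀ z ∈ Z, F ∈ (f z).asHomogeneousIdeal) ∧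
      F ∉ (f x).asHomogeneousIdeal := by
  classical
  have hZc : IsClosed (f '' Z) := hf.isClosedMap _ hZ
  have hI : ¬ ProjectiveSpectrum.vanishingIdeal (f '' Z) ≤ (f x).asHomogeneousIdeal := by
    intro hle
    have hxZ : f x ∈ ProjectiveSpectrum.zeroLocus 𝒜
        (ProjectiveSpectrum.vanishingIdeal (f '' Z) : Set A) := hle
    rw [ProjectiveSpectrum.zeroLocus_vanishingIdeal_eq_closure, hZc.closure_eq] at hxZ
    obtain ⟨z, hz, hzx⟩ := hxZ
    exact hx (hf.injective hzx ▸ hz)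
  -- the point `f x` of the scheme `Proj A` (same underlying set as `ProjectiveSpectrum 𝒜`)
  obtain ⟨F, ⟨k, hk, hFk, hFI⟩, hFx⟩ :=
    Motives.GradedPrimeAvoidance.exists_posHomog_notMem_point 𝒜 _ (show Proj 𝒜 from f x) hI
  exact ⟨k, F, hk, hFk, fun z hz ↦
    (ProjectiveSpectrum.mem_vanishingIdeal _ F).mp hFI (f z) ⟨z, hz, rfl⟩, hFx⟩

variable {X : Motives.SchemeOver ℂ}

/-- **BFNP Lemma 49 in the hypersurface-section rendering** ("there exists a divisor
`D ∈ |𝓛^m|` such that `Z ⊂ D`", for `𝓛 = 𝒪_X(1)` of the embedding `e : X ↪ ℙᴺ_ℂ`): a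
Zariski-closed `Z ⊆ X` missing a point `x` lies in the hypersurface section `e⁻¹ V₊(F)` cut by an
ambient form `F` of some degree `k ≥ 1` which does not vanish at `e(x)` (so `e⁻¹ V₊(F) ≠ X`).
Proof: graded prime avoidance (`exists_homogeneous_mem_forall_notMem`) for the closed embedding
`e`. [cite: BrosnanFangNiePearlstein2009, §6 Lemma 49] -/
theorem exists_form_vanishing_of_notMem (e : Motives.ProjectiveEmbedding X) {Z : Set X.left}
    (hZ : IsClosed Z) {x : X.left} (hx : x ∉ Z) :
    ∃ (k : ℕ) (F : MvPolynomial (Fin (e.n + 1)) ℂ), 0 < k ∧ F.IsHomogeneous k ∧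
      Z ⊆ e.ι.left.base ⁻¹' (letI := MvPolynomial.gradedAlgebra (σ := Fin (e.n + 1)) (R := ℂ);
        ProjectiveSpectrum.zeroLocus (MvPolynomial.homogeneousSubmodule (Fin (e.n + 1)) ℂ) {F}) ∧
      x ∉ e.ι.left.base ⁻¹' (letI := MvPolynomial.gradedAlgebra (σ := Fin (e.n + 1)) (R := ℂ);
        ProjectiveSpectrum.zeroLocus (MvPolynomial.homogeneousSubmodule (Fin (e.n + 1)) ℂ) {F}) := by
  letI := MvPolynomial.gradedAlgebra (σ := Fin (e.n + 1)) (R := ℂ)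
  obtain ⟨k, F, hk, hFk, hFZ, hFx⟩ := exists_homogeneous_mem_forall_notMem
    (MvPolynomial.homogeneousSubmodule (Fin (e.n + 1)) ℂ)
    (f := fun y ↦ (e.ι.left.base y :
      ProjectiveSpectrum (MvPolynomial.homogeneousSubmodule (Fin (e.n + 1)) ℂ)))
    e.ι.left.isClosedEmbedding hZ hx
  refine ⟨k, F, hk, (MvPolynomial.mem_homogeneousSubmodule k F).mp hFk, fun z hz ↦ ?_, fun h ↦ ?_⟩
  · exact Set.singleton_subset_iff.mpr (hFZ z hz)
  · exact hFx (Set.singleton_subset_iff.mp h)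

/-- A closed subset all of whose points have codimension `≥ r ≥ 1` in a smooth projective
variety `X` is a PROPER subset: it misses the generic point of the irreducible space `X`, which
has codimension `0` (it is maximal for the specialisation order of `Scheme`). [folklore] -/
theorem exists_notMem_of_coheight {m : ℕ} (hX : Motives.IsSmoothProjective m X)
    {Z : Set X.left} {r : ℕ} (hr : ∀ z ∈ Z, (r : ℕ∞) ≤ Order.coheight z) (h1 : 1 ≤ r) :
    ∃ x : X.left, x ∉ Z := by
  haveI : IrreducibleSpace X.left :=
    haveI := hX.geometricallyIrreducible
    GeometricallyIrreducible.irreducibleSpace_of_subsingleton X.hom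
  refine ⟨genericPoint X.left, fun hη ↦ ?_⟩
  have h0 : Order.coheight (genericPoint X.left) = 0 := by
    rw [Order.coheight_eq_zero]
    intro b _
    exact Scheme.le_iff_specializes.2 ((genericPoint_spec X.left).specializes (Set.mem_univ b))
  have h := hr _ hη
  rw [h0, nonpos_iff_eq_zero, Nat.cast_eq_zero] at h
  omega

/-! ### (C) Cup product with supports: an open neighbourhood and an open complement -/

/-- **Cup product with supports, neighbourhood form** (Hatcher §3.2 p. 209, for the open cover
`{V, (X ∖ Z)(ℂ)}` of `X(ℂ)`): if `c ∈ Hᵖ(X(ℂ); ℂ)` vanishes on an open `V ⊆ X(ℂ)` containing `Z(ℂ)`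
(`Z` Zariski-closed) and `a ∈ Hᵠ(X(ℂ); ℂ)` vanishes on `(X ∖ Z)(ℂ)`, then `c ∪ a = 0`: by
`map_cupProduct_eq_zero_of_isOpen` the product vanishes on `(X ∖ ∅)(ℂ) ⊆ V ∪ (X ∖ Z)(ℂ)`, and no
non-zero class is supported on `∅` (`classesSupportedOn_empty`). This is the topological half of
"`ζ ∪ [Zᵢ] ≠ 0`, equivalently `ζ|_{Zᵢ} ≠ 0`". [cite: HatcherAT2002, §3.2 p. 209] -/
theorem cupProduct_eq_zero_of_isOpen_of_restrictCompl {V : Set (Motives.ComplexPoints X)}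
    (hV : IsOpen V) {Z : Set X.left} (hZ : IsClosed Z)
    (hZV : ∀ P : Motives.ComplexPoints X, P.pt ∈ Z → P ∈ V)
    {p q m : ℕ} (h : p + q = m) {c : complexBetti X p} {a : complexBetti X q}
    (hc : singularCohomology.map ℂ ℂ (subsetIncl V) p c = 0)
    (ha : complexBetti.restrictCompl X Z q a = 0) :
    cupProduct h c a = 0 := by
  have h0 : complexBetti.restrictCompl X ∅ m (cupProduct h c a) = 0 :=
    map_cupProduct_eq_zero_of_isOpen (Y := Motives.ComplexPoints X) (U := V)
      (V := {P | P.pt ∉ Z}) hV (isOpen_setOf_pt_not_mem hZ) h hc ha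
      (S := {P | P.pt ∉ (∅ : Set X.left)})
      (fun P _ ↦ by
        by_cases hP : P.pt ∈ Z
        · exact Or.inl (hZV P hP)
        · exact Or.inr hP)
  have hmem : cupProduct h c a ∈ classesSupportedOn X ∅ m := mem_classesSupportedOn_iff.mpr h0
  rwa [classesSupportedOn_empty, Submodule.mem_bot] at hmem

/-! ### (T) Tautness of `Z(ℂ)` from local contractibility (Spanier Thm. 6.1.10, proved in the tree) -/

/-- Pull-back along `i ∘ j` vanishes if it vanishes along `i ∘ g` for some `g` homotopic to `j`
(homotopy invariance of singular cohomology, Hatcher §3.1 p. 201). [cite: HatcherAT2002, §3.1 p. 201] -/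
theorem map_comp_eq_zero_of_homotopic {A B Y : Type u} [TopologicalSpace A] [TopologicalSpace B]
    [TopologicalSpace Y] (i : C(B, Y)) {j g : C(A, B)} (h : j.Homotopic g) {k : ℕ}
    (c : singularCohomology ℂ ℂ Y k) (hg : singularCohomology.map ℂ ℂ (i.comp g) k c = 0) :
    singularCohomology.map ℂ ℂ (i.comp j) k c = 0 := by
  rw [singularCohomology.map_comp, ModuleCat.comp_apply,
    singularCohomology.map_eq_of_homotopic' ℂ ℂ h k, ← ModuleCat.comp_apply,
    ← singularCohomology.map_comp, hg]

/-- **Tautness of `Z(ℂ)` in `X(ℂ)` from local contractibility** (Spanier, Ch. 6 §1 Thm. 10 and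
Cor. 11; Hatcher Thm. A.7, Cor. A.9 — all PROVED in the tree): for `X` smooth projective over `ℂ`
and `Z ⊆ X` Zariski-closed with `Z(ℂ) = {P ∈ X(ℂ) | pt P ∈ Z}` locally contractible, a class
`c ∈ Hᵏ(X(ℂ); ℂ)` vanishing on `Z(ℂ)` vanishes on some open neighbourhood `V ⊇ Z(ℂ)`. Proof:
`X(ℂ)` is a compact topological manifold (GAGA charts), so it embeds in some `ℝᴺ` with image a
neighbourhood retract (`exists_isClosedEmbedding_pi_of_compactSpace`,
`isNeighbourhoodRetract_range_of_compactSpace` fed with the proved Thm. A.7); the compact, locally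
contractible `Z(ℂ)` then carries a tautness datum (`Cech.RetractionNhds.nonempty_of_locallyContractibleSpace`):
a retraction `r : U₀ → Z(ℂ)` of an open `U₀` and an open `Z(ℂ) ⊆ V ⊆ U₀` on which the inclusion
is homotopic to `V →ʳ Z(ℂ) ↪ U₀`; by homotopy invariance `c|_V = r^*(c|_{Z(ℂ)}) = 0`.
[cite: Spanier1981, Ch. 6 §1, Thm. 10 and Cor. 11] [cite: HatcherAT2002, Thm. A.7 and Cor. A.9] -/
theorem exists_isOpen_map_eq_zero_of_locallyContractibleSpace {m : ℕ}
    (hX : Motives.IsSmoothProjective m X) {Z : Set X.left} (hZ : IsClosed Z)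
    (hLC : LocallyContractibleSpace {P : Motives.ComplexPoints X // P.pt ∈ Z}) {k : ℕ}
    (c : complexBetti X k)
    (hc : singularCohomology.map ℂ ℂ
      (⟨Subtype.val, continuous_subtype_val⟩ :
        C({P : Motives.ComplexPoints X // P.pt ∈ Z}, Motives.ComplexPoints X)) k c = 0) :
    ∃ V : Set (Motives.ComplexPoints X), IsOpen V ∧
      (∀ P : Motives.ComplexPoints X, P.pt ∈ Z → P ∈ V) ∧
      singularCohomology.map ℂ ℂ (subsetIncl V) k c = 0 := by
  classical
  letI := hX.chartedSpace
  haveI := Motives.ComplexPoints.compactSpace_of_isSmoothProjective hX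
  haveI := Motives.ComplexPoints.t2Space_of_isSmoothProjective hX
  -- `X(ℂ) ↪ ℝᴺ` with image a neighbourhood retract
  obtain ⟨N, f, hf⟩ := Literature.Geometry.Manifold.exists_isClosedEmbedding_pi_of_compactSpace
    (M := Motives.ComplexPoints X) (EuclideanSpace ℝ (Fin (2 * m)))
  have hNR : IsNeighbourhoodRetract (Set.range f) :=
    isNeighbourhoodRetract_range_of_compactSpace
      isNeighbourhoodRetract_of_locallyContractibleSpace_holds (EuclideanSpace ℝ (Fin (2 * m)))
      hf.isEmbedding
  -- the compact, locally contractible `K = Z(ℂ)`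
  have hKclosed : IsClosed {P : Motives.ComplexPoints X | P.pt ∈ Z} :=
    ⟨isOpen_setOf_pt_not_mem hZ⟩
  obtain ⟨T⟩ := Cech.RetractionNhds.nonempty_of_locallyContractibleSpace
    (K := {P : Motives.ComplexPoints X | P.pt ∈ Z}) hf.isEmbedding hNR hKclosed.isCompact hLC
  obtain ⟨V, hVo, hKV, hVU, hhom⟩ := T.homotopic T.U₀ T.isOpen T.subset Set.Subset.rfl
  refine ⟨V, hVo, fun P hP ↦ hKV hP, ?_⟩
  change singularCohomology.map ℂ ℂ
    ((subsetIncl T.U₀).comp (ContinuousMap.inclusion hVU)) k c = 0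
  refine map_comp_eq_zero_of_homotopic (subsetIncl T.U₀) hhom c ?_
  change singularCohomology.map ℂ ℂ
    ((⟨Subtype.val, continuous_subtype_val⟩ :
        C({P : Motives.ComplexPoints X // P.pt ∈ Z}, Motives.ComplexPoints X)).comp
      (T.r.comp (ContinuousMap.inclusion hVU))) k c = 0
  rw [singularCohomology.map_comp, ModuleCat.comp_apply, hc, map_zero]

/-! ### Lemma 50: the printed proof, with (P) and (T) as hypotheses -/

/-- **The topological core of BFNP Lemma 50** (no Hodge theory; any dimension). Let `X` be
smooth projective over `ℂ`, `n ≥ 1`, and assume (T) tautness of the Zariski-closed subsets of `X`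
for `H^{2n}(–; ℂ)`: a class vanishing on `Z(ℂ)` vanishes on some open neighbourhood of `Z(ℂ)` in
`X(ℂ)`. If `c ∈ H^{2n}(X(ℂ); ℂ)` pairs non-trivially with SOME algebraic class,
`c ∪ d ≠ 0` for a `d ∈ Nⁿ H^{2n}(X(ℂ); ℂ) = algebraicClasses X n` ("`ζ ∪ α ≠ 0`, `α = Σ aᵢ [Zᵢ]`"),
then `c` restricts non-trivially to some hypersurface section `e⁻¹ V₊(F) ≠ X`, `deg F ≥ 1`
("`ζ ∪ [Zᵢ] ≠ 0` … equivalently `0 ≠ ζ|_{Zᵢ}` … the lemma then follows from Lemma 49").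
Proof: the classes pairing to zero with `c` form a submodule, and `Nⁿ H^{2n}` is spanned by
classes `a'` killed off closed `Z` of codimension `≥ n` (`supportedClasses_le`); such a `Z` is a
proper subset (`exists_notMem_of_coheight`), hence inside a hypersurface section
`D = e⁻¹ V₊(F) ≠ X` (Lemma 49, `exists_form_vanishing_of_notMem`); if `c` restricted to zero on
every hypersurface section it would vanish on `D(ℂ)`, hence (T) on an open `V ⊇ D(ℂ) ⊇ Z(ℂ)`,
so `c ∪ a' = 0` (`cupProduct_eq_zero_of_isOpen_of_restrictCompl`) for all generators `a'`, whence
`c ∪ d = 0` — a contradiction. [cite: BrosnanFangNiePearlstein2009, §6 Lemma 50] -/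
theorem exists_sectionRestriction_ne_zero_of_cup_ne_zero {m n : ℕ} (hn : 0 < n)
    (hX : Motives.IsSmoothProjective m X)
    (hTaut : ∀ (Z : Set X.left), IsClosed Z → ∀ c : complexBetti X (2 * n),
      singularCohomology.map ℂ ℂ
          (⟨Subtype.val, continuous_subtype_val⟩ :
            C({P : Motives.ComplexPoints X // P.pt ∈ Z}, Motives.ComplexPoints X)) (2 * n) c = 0 →
        ∃ V : Set (Motives.ComplexPoints X), IsOpen V ∧
          (∀ P : Motives.ComplexPoints X, P.pt ∈ Z → P ∈ V) ∧
          singularCohomology.map ℂ ℂ (subsetIncl V) (2 * n) c = 0)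
    (e : Motives.ProjectiveEmbedding X) {c d : complexBetti X (2 * n)}
    (hd : d ∈ algebraicClasses X n)
    (hcd : cupProduct (rfl : 2 * n + 2 * n = 2 * n + 2 * n) c d ≠ 0) :
    ∃ (k : ℕ) (F : MvPolynomial (Fin (e.n + 1)) ℂ) (Z : Set X.left), 0 < k ∧ F.IsHomogeneous k ∧
      Z = e.ι.left.base ⁻¹' (letI := MvPolynomial.gradedAlgebra (σ := Fin (e.n + 1)) (R := ℂ);
        ProjectiveSpectrum.zeroLocus (MvPolynomial.homogeneousSubmodule (Fin (e.n + 1)) ℂ) {F}) ∧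
      Z ≠ Set.univ ∧
      singularCohomology.map ℂ ℂ
        (⟨Subtype.val, continuous_subtype_val⟩ :
          C({P : Motives.ComplexPoints X // P.pt ∈ Z}, Motives.ComplexPoints X)) (2 * n) c ≠ 0 := by
  classical
  letI := MvPolynomial.gradedAlgebra (σ := Fin (e.n + 1)) (R := ℂ)
  by_contra hall
  push Not at hall
  -- every algebraic class pairs to zero with `c`
  have key : algebraicClasses X n ≤
      LinearMap.ker (cupProduct (rfl : 2 * n + 2 * n = 2 * n + 2 * n) c) := by
    refine supportedClasses_le fun Z hZ hcodim ↦ ?_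
    intro a' ha'
    rw [LinearMap.mem_ker] at ha' ⊢
    -- `Z` is a proper closed subset: it lies in a hypersurface section `D ≠ X` (Lemma 49)
    obtain ⟨x, hx⟩ := exists_notMem_of_coheight hX hcodim (Nat.one_le_iff_ne_zero.mpr hn.ne')
    obtain ⟨k, F, hk, hFk, hZF, hxF⟩ := exists_form_vanishing_of_notMem e hZ hx
    have hD : e.ι.left.base ⁻¹'
        ProjectiveSpectrum.zeroLocus (MvPolynomial.homogeneousSubmodule (Fin (e.n + 1)) ℂ) {F} ≠
          Set.univ :=
      fun h ↦ hxF (Set.eq_univ_iff_forall.mp h x)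
    -- by assumption `c` vanishes on `D(ℂ)` …
    have hcD := hall k F _ hk hFk rfl hD
    -- … hence, by (T), on an open neighbourhood `V ⊇ D(ℂ) ⊇ Z(ℂ)`
    have hDc : IsClosed (e.ι.left.base ⁻¹'
        ProjectiveSpectrum.zeroLocus (MvPolynomial.homogeneousSubmodule (Fin (e.n + 1)) ℂ) {F}) :=
      (ProjectiveSpectrum.isClosed_zeroLocus _ _).preimage e.ι.left.continuous
    obtain ⟨V, hV, hDV, hcV⟩ := hTaut _ hDc c hcD
    -- so `c ∪ a' = 0` (cup product with supports)
    exact cupProduct_eq_zero_of_isOpen_of_restrictCompl hV hZ (fun P hP ↦ hDV P (hZF hP)) rfl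
      hcV ha'
  exact hcd (LinearMap.mem_ker.mp (key hd))

/-- **BFNP Lemma 50 for one `X`, reduced to its two analytic inputs** (the printed proof,
formalised). Let `X` be smooth projective of dimension `2n ≥ 2` over `ℂ` for which the Hodge
conjecture holds, and assume for this `X`:
(P) non-degeneracy of the cup-product pairing on the rational `(n, n)`-classes of `H^{2n}(X(ℂ); ℂ)`
("By Poincaré duality and the Hodge–Riemann relations, there exists a class `α ∈ Hdg^{2n}(X)`
such that `0 ≠ α ∪ ζ`"), and
(T) tautness of the Zariski-closed subsets for `H^{2n}(–; ℂ)`.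
Then every non-zero rational `(n, n)`-class `c` restricts non-trivially to some hypersurface
section `e⁻¹ V₊(F) ≠ X`, `deg F ≥ 1`: the partner `a` of (P) is algebraic by the Hodge conjecture
for `X` ("we can write `α = Σ aᵢ [Zᵢ]`"), and the topological core
`exists_sectionRestriction_ne_zero_of_cup_ne_zero` applies. [cite: BrosnanFangNiePearlstein2009, §6 Lemma 50] -/
theorem exists_sectionRestriction_ne_zero_of_pairing_of_taut {n : ℕ} (hn : 0 < n)
    (hX : Motives.IsSmoothProjective (2 * n) X) (hHC : HodgeConjectureFor (2 * n) X)
    (hPair : ∀ c : complexBetti X (2 * n), IsRationalClass c →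
      IsOfHodgeType (2 * n) X (2 * n) n n c → c ≠ 0 →
        ∃ a : complexBetti X (2 * n), IsRationalClass a ∧ IsOfHodgeType (2 * n) X (2 * n) n n a ∧
          cupProduct (rfl : 2 * n + 2 * n = 2 * n + 2 * n) c a ≠ 0)
    (hTaut : ∀ (Z : Set X.left), IsClosed Z → ∀ c : complexBetti X (2 * n),
      singularCohomology.map ℂ ℂ
          (⟨Subtype.val, continuous_subtype_val⟩ :
            C({P : Motives.ComplexPoints X // P.pt ∈ Z}, Motives.ComplexPoints X)) (2 * n) c = 0 →
        ∃ V : Set (Motives.ComplexPoints X), IsOpen V ∧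
          (∀ P : Motives.ComplexPoints X, P.pt ∈ Z → P ∈ V) ∧
          singularCohomology.map ℂ ℂ (subsetIncl V) (2 * n) c = 0)
    (e : Motives.ProjectiveEmbedding X) (c : complexBetti X (2 * n)) (hc : IsRationalClass c)
    (hH : IsOfHodgeType (2 * n) X (2 * n) n n c) (hne : c ≠ 0) :
    ∃ (k : ℕ) (F : MvPolynomial (Fin (e.n + 1)) ℂ) (Z : Set X.left), 0 < k ∧ F.IsHomogeneous k ∧
      Z = e.ι.left.base ⁻¹' (letI := MvPolynomial.gradedAlgebra (σ := Fin (e.n + 1)) (R := ℂ);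
        ProjectiveSpectrum.zeroLocus (MvPolynomial.homogeneousSubmodule (Fin (e.n + 1)) ℂ) {F}) ∧
      Z ≠ Set.univ ∧
      singularCohomology.map ℂ ℂ
        (⟨Subtype.val, continuous_subtype_val⟩ :
          C({P : Motives.ComplexPoints X // P.pt ∈ Z}, Motives.ComplexPoints X)) (2 * n) c ≠ 0 := by
  -- (P): a rational `(n, n)`-class `a` with `c ∪ a ≠ 0`; (H): `a` is algebraic
  obtain ⟨a, haQ, haH, hca⟩ := hPair c hc hH hne
  exact exists_sectionRestriction_ne_zero_of_cup_ne_zero hn hX hTaut e (hHC.2 n a haQ haH) hca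

/-- **The named fact from its two analytic inputs.** Granted, for all smooth projective complex
`2n`-folds (`n ≥ 1`), (P) the non-degeneracy of the cup-product pairing on rational
`(n, n)`-classes ("Poincaré duality and the Hodge–Riemann bilinear relations": BFNP §6, the
perfect pairing `Hdg^n X ⊗ Hdg^n X → ℚ`) and (T) the tautness of Zariski-closed subsets `Z(ℂ)`
in `X(ℂ)` for `H^{2n}(–; ℂ)`, the printed proof of Lemma 50
(`exists_sectionRestriction_ne_zero_of_pairing_of_taut`) yields
`hodgeSectionRestriction_of_hodgeConjectureFor`. [cite: BrosnanFangNiePearlstein2009, §6 Lemma 50] -/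
theorem hodgeSectionRestriction_of_hodgeConjectureFor_of_pairing_of_taut
    (hPair : ∀ ⦃n : ℕ⦄ ⦃X : Motives.SchemeOver ℂ⦄, 0 < n → Motives.IsSmoothProjective (2 * n) X →
      ∀ c : complexBetti X (2 * n), IsRationalClass c → IsOfHodgeType (2 * n) X (2 * n) n n c →
        c ≠ 0 → ∃ a : complexBetti X (2 * n), IsRationalClass a ∧
          IsOfHodgeType (2 * n) X (2 * n) n n a ∧
          cupProduct (rfl : 2 * n + 2 * n = 2 * n + 2 * n) c a ≠ 0)
    (hTaut : ∀ ⦃n : ℕ⦄ ⦃X : Motives.SchemeOver ℂ⦄, Motives.IsSmoothProjective (2 * n) X →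
      ∀ (Z : Set X.left), IsClosed Z → ∀ c : complexBetti X (2 * n),
        singularCohomology.map ℂ ℂ
            (⟨Subtype.val, continuous_subtype_val⟩ :
              C({P : Motives.ComplexPoints X // P.pt ∈ Z}, Motives.ComplexPoints X)) (2 * n) c = 0 →
          ∃ V : Set (Motives.ComplexPoints X), IsOpen V ∧
            (∀ P : Motives.ComplexPoints X, P.pt ∈ Z → P ∈ V) ∧
            singularCohomology.map ℂ ℂ (subsetIncl V) (2 * n) c = 0) :
    hodgeSectionRestriction_of_hodgeConjectureFor :=
  fun _ _ hn hX hHC e c hc hH hne ↦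
    exists_sectionRestriction_ne_zero_of_pairing_of_taut hn hX hHC (hPair hn hX) (hTaut hX) e c hc
      hH hne

/-! ### The reductions with local contractibility of algebraic subsets in place of tautness -/

/-- **The topological core with (LC) in place of (T)**: for `X` smooth projective over `ℂ`,
`n ≥ 1`, granted that the complex points `Z(ℂ)` of every Zariski-closed `Z ⊆ X` form a locally
contractible space (complex algebraic sets are triangulable, hence locally contractible — the one
topological input not in the tree), a class `c ∈ H^{2n}(X(ℂ); ℂ)` with `c ∪ d ≠ 0` for some
algebraic `d ∈ Nⁿ H^{2n}(X(ℂ); ℂ)` restricts non-trivially to some hypersurface section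
`e⁻¹ V₊(F) ≠ X`, `deg F ≥ 1` (`exists_sectionRestriction_ne_zero_of_cup_ne_zero` with tautness
supplied by `exists_isOpen_map_eq_zero_of_locallyContractibleSpace`).
[cite: BrosnanFangNiePearlstein2009, §6 Lemma 50] -/
theorem exists_sectionRestriction_ne_zero_of_cup_ne_zero_of_locallyContractible {m n : ℕ}
    (hn : 0 < n) (hX : Motives.IsSmoothProjective m X)
    (hLC : ∀ Z : Set X.left, IsClosed Z →
      LocallyContractibleSpace {P : Motives.ComplexPoints X // P.pt ∈ Z})
    (e : Motives.ProjectiveEmbedding X) {c d : complexBetti X (2 * n)}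
    (hd : d ∈ algebraicClasses X n)
    (hcd : cupProduct (rfl : 2 * n + 2 * n = 2 * n + 2 * n) c d ≠ 0) :
    ∃ (k : ℕ) (F : MvPolynomial (Fin (e.n + 1)) ℂ) (Z : Set X.left), 0 < k ∧ F.IsHomogeneous k ∧
      Z = e.ι.left.base ⁻¹' (letI := MvPolynomial.gradedAlgebra (σ := Fin (e.n + 1)) (R := ℂ);
        ProjectiveSpectrum.zeroLocus (MvPolynomial.homogeneousSubmodule (Fin (e.n + 1)) ℂ) {F}) ∧
      Z ≠ Set.univ ∧
      singularCohomology.map ℂ ℂ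
        (⟨Subtype.val, continuous_subtype_val⟩ :
          C({P : Motives.ComplexPoints X // P.pt ∈ Z}, Motives.ComplexPoints X)) (2 * n) c ≠ 0 :=
  exists_sectionRestriction_ne_zero_of_cup_ne_zero hn hX
    (fun Z hZ c hc ↦ exists_isOpen_map_eq_zero_of_locallyContractibleSpace hX hZ (hLC Z hZ) c hc)
    e hd hcd

/-- **BFNP Lemma 50 for one `2n`-fold from (P), (LC) and the Hodge conjecture for it**: as
`exists_sectionRestriction_ne_zero_of_pairing_of_taut`, with the tautness hypothesis (T) replaced
by the local contractibility (LC) of the complex points of the Zariski-closed subsets of `X`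
(`exists_isOpen_map_eq_zero_of_locallyContractibleSpace`). [cite: BrosnanFangNiePearlstein2009, §6 Lemma 50] -/
theorem exists_sectionRestriction_ne_zero_of_pairing_of_locallyContractible {n : ℕ} (hn : 0 < n)
    (hX : Motives.IsSmoothProjective (2 * n) X) (hHC : HodgeConjectureFor (2 * n) X)
    (hPair : ∀ c : complexBetti X (2 * n), IsRationalClass c →
      IsOfHodgeType (2 * n) X (2 * n) n n c → c ≠ 0 →
        ∃ a : complexBetti X (2 * n), IsRationalClass a ∧ IsOfHodgeType (2 * n) X (2 * n) n n a ∧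
          cupProduct (rfl : 2 * n + 2 * n = 2 * n + 2 * n) c a ≠ 0)
    (hLC : ∀ Z : Set X.left, IsClosed Z →
      LocallyContractibleSpace {P : Motives.ComplexPoints X // P.pt ∈ Z})
    (e : Motives.ProjectiveEmbedding X) (c : complexBetti X (2 * n)) (hc : IsRationalClass c)
    (hH : IsOfHodgeType (2 * n) X (2 * n) n n c) (hne : c ≠ 0) :
    ∃ (k : ℕ) (F : MvPolynomial (Fin (e.n + 1)) ℂ) (Z : Set X.left), 0 < k ∧ F.IsHomogeneous k ∧
      Z = e.ι.left.base ⁻¹' (letI := MvPolynomial.gradedAlgebra (σ := Fin (e.n + 1)) (R := ℂ);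
        ProjectiveSpectrum.zeroLocus (MvPolynomial.homogeneousSubmodule (Fin (e.n + 1)) ℂ) {F}) ∧
      Z ≠ Set.univ ∧
      singularCohomology.map ℂ ℂ
        (⟨Subtype.val, continuous_subtype_val⟩ :
          C({P : Motives.ComplexPoints X // P.pt ∈ Z}, Motives.ComplexPoints X)) (2 * n) c ≠ 0 := by
  obtain ⟨a, haQ, haH, hca⟩ := hPair c hc hH hne
  exact exists_sectionRestriction_ne_zero_of_cup_ne_zero_of_locallyContractible hn hX hLC e
    (hHC.2 n a haQ haH) hca

/-- **The named fact from (P) and (LC).** Granted (P) the non-degeneracy of the cup-product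
pairing on rational `(n, n)`-classes of every smooth projective complex `2n`-fold, `n ≥ 1`
("Poincaré duality and the Hodge–Riemann bilinear relations", BFNP §6, the perfect pairing
`Hdg^n X ⊗ Hdg^n X → ℚ`), and (LC) the local contractibility of the complex points `Z(ℂ)` of the
Zariski-closed subsets `Z` of smooth projective complex varieties (complex algebraic sets are
triangulable), the printed proof of Lemma 50 yields `hodgeSectionRestriction_of_hodgeConjectureFor`;
every other ingredient (tautness from (LC), cup product with supports, Lemma 49, the unpacking of
the Hodge conjecture on the coniveau carrier) is proved in this file and its imports.
[cite: BrosnanFangNiePearlstein2009, §6 Lemma 50] -/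
theorem hodgeSectionRestriction_of_hodgeConjectureFor_of_pairing_of_locallyContractible
    (hPair : ∀ ⦃n : ℕ⦄ ⦃X : Motives.SchemeOver ℂ⦄, 0 < n → Motives.IsSmoothProjective (2 * n) X →
      ∀ c : complexBetti X (2 * n), IsRationalClass c → IsOfHodgeType (2 * n) X (2 * n) n n c →
        c ≠ 0 → ∃ a : complexBetti X (2 * n), IsRationalClass a ∧
          IsOfHodgeType (2 * n) X (2 * n) n n a ∧
          cupProduct (rfl : 2 * n + 2 * n = 2 * n + 2 * n) c a ≠ 0)
    (hLC : ∀ ⦃n : ℕ⦄ ⦃X : Motives.SchemeOver ℂ⦄, Motives.IsSmoothProjective n X →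
      ∀ Z : Set X.left, IsClosed Z →
        LocallyContractibleSpace {P : Motives.ComplexPoints X // P.pt ∈ Z}) :
    hodgeSectionRestriction_of_hodgeConjectureFor :=
  fun _ _ hn hX hHC e c hc hH hne ↦
    exists_sectionRestriction_ne_zero_of_pairing_of_locallyContractible hn hX hHC (hPair hn hX)
      (hLC hX) e c hc hH hne

/-! ### Support form of the printed proof (approach B): tautness of the SUPPORT `Zᵢ(ℂ)` only, restriction to EVERY hypersurface section through `Zᵢ`, in EVERY large degree

The printed proof reads "`0 ≠ ζ|_{Zᵢ} ∈ H^{2n}(Zᵢ, ℚ(n))`. The lemma then follows from Lemma 49",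
i.e. the non-vanishing is established on the SUPPORT `Zᵢ` of the algebraic partner and then
transported to any divisor `D ⊇ Zᵢ` by functoriality of restriction (`Zᵢ(ℂ) ⊆ D(ℂ) ⊆ X(ℂ)`).
Formalised this way, the tautness input (T) is needed only for the Zariski-closed subsets of
codimension `≥ n` that support algebraic classes (not for the hypersurface sections `D(ℂ)`), and
the conclusion comes out in the strength in which Theorem 51 of the source USES Lemma 50 ("there
exists an integer `N` such that, for every `m ≥ N`, there exists `p ∈ |𝓛^m|` such that
`ζ|_{𝒳_p} ≠ 0`"): for ALL degrees `k ≥ k₀` there is a form `F` of degree `k` with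
`c|_{(X ∩ V₊(F))(ℂ)} ≠ 0` — multiply the form of Lemma 49 by powers of a coordinate not vanishing
at a chosen point off `Zᵢ`. No new named fact (D-0026); (P) and (T)/(LC) remain hypotheses. -/

/-- **Restriction is functorial in the closed subset**: for `Z ⊆ D ⊆ X`, the restriction
`Hᵏ(X(ℂ)) → Hᵏ(Z(ℂ))` factors through `Hᵏ(D(ℂ))`, so `c|_{Z(ℂ)} ≠ 0` forces `c|_{D(ℂ)} ≠ 0`
("`0 ≠ ζ|_{Zᵢ}` … the lemma then follows from Lemma 49": `Zᵢ ⊂ D`). [cite: HatcherAT2002, §3.1] -/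
theorem map_ne_zero_of_subset {Z D : Set X.left} (hZD : Z ⊆ D) {k : ℕ} {c : complexBetti X k}
    (hc : singularCohomology.map ℂ ℂ
      (⟨Subtype.val, continuous_subtype_val⟩ :
        C({P : Motives.ComplexPoints X // P.pt ∈ Z}, Motives.ComplexPoints X)) k c ≠ 0) :
    singularCohomology.map ℂ ℂ
      (⟨Subtype.val, continuous_subtype_val⟩ :
        C({P : Motives.ComplexPoints X // P.pt ∈ D}, Motives.ComplexPoints X)) k c ≠ 0 := by
  intro hD
  apply hc
  have hfac : (⟨Subtype.val, continuous_subtype_val⟩ :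
        C({P : Motives.ComplexPoints X // P.pt ∈ Z}, Motives.ComplexPoints X)) =
      (⟨Subtype.val, continuous_subtype_val⟩ :
        C({P : Motives.ComplexPoints X // P.pt ∈ D}, Motives.ComplexPoints X)).comp
        (⟨fun P ↦ ⟨P.1, hZD P.2⟩, by fun_prop⟩ :
          C({P : Motives.ComplexPoints X // P.pt ∈ Z}, {P : Motives.ComplexPoints X // P.pt ∈ D})) :=
    rfl
  rw [hfac, singularCohomology.map_comp, ModuleCat.comp_apply, hD, map_zero]

/-- **"`ζ ∪ [Zᵢ] ≠ 0`, equivalently `0 ≠ ζ|_{Zᵢ}`", support form.** If `a ∈ H^q(X(ℂ); ℂ)` vanishes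
on `(X ∖ Z)(ℂ)` (`a` supported on the Zariski-closed `Z`), `c ∪ a ≠ 0`, and `Z(ℂ)` is taut in
`X(ℂ)` for the class `c` (if `c|_{Z(ℂ)} = 0` then `c` vanishes on some open `V ⊇ Z(ℂ)`), then
`c|_{Z(ℂ)} ≠ 0`: otherwise `c|_V = 0` and `a|_{(X ∖ Z)(ℂ)} = 0` for the open cover
`{V, (X ∖ Z)(ℂ)}` of `X(ℂ)` give `c ∪ a = 0` (`cupProduct_eq_zero_of_isOpen_of_restrictCompl`,
Hatcher §3.2 p. 209). [cite: BrosnanFangNiePearlstein2009, §6 Lemma 50]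
[cite: HatcherAT2002, §3.2 p. 209] -/
theorem map_ne_zero_of_cupProduct_ne_zero_of_taut {Z : Set X.left} (hZ : IsClosed Z)
    {p q m : ℕ} (h : p + q = m) {c : complexBetti X p} {a : complexBetti X q}
    (ha : complexBetti.restrictCompl X Z q a = 0)
    (hTaut : singularCohomology.map ℂ ℂ
        (⟨Subtype.val, continuous_subtype_val⟩ :
          C({P : Motives.ComplexPoints X // P.pt ∈ Z}, Motives.ComplexPoints X)) p c = 0 →
      ∃ V : Set (Motives.ComplexPoints X), IsOpen V ∧
        (∀ P : Motives.ComplexPoints X, P.pt ∈ Z → P ∈ V) ∧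
        singularCohomology.map ℂ ℂ (subsetIncl V) p c = 0)
    (hca : cupProduct h c a ≠ 0) :
    singularCohomology.map ℂ ℂ
      (⟨Subtype.val, continuous_subtype_val⟩ :
        C({P : Motives.ComplexPoints X // P.pt ∈ Z}, Motives.ComplexPoints X)) p c ≠ 0 := by
  intro hc0
  obtain ⟨V, hV, hZV, hcV⟩ := hTaut hc0
  exact hca (cupProduct_eq_zero_of_isOpen_of_restrictCompl hV hZ hZV h hcV ha)

/-- Some homogeneous coordinate `xⱼ` does not vanish at a given point of `ℙᴺ_ℂ`: the points of
`Proj ℂ[x₀, …, x_N]` are the relevant homogeneous primes, and the irrelevant ideal is generated by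
the variables (`Motives.Segre.irrelevant_le_span_X`; Hartshorne II Prop. 2.5).
[folklore] -/
theorem exists_X_notMem_asHomogeneousIdeal {N : ℕ}
    (p : letI := MvPolynomial.gradedAlgebra (σ := Fin (N + 1)) (R := ℂ);
      ProjectiveSpectrum (MvPolynomial.homogeneousSubmodule (Fin (N + 1)) ℂ)) :
    letI := MvPolynomial.gradedAlgebra (σ := Fin (N + 1)) (R := ℂ);
    ∃ j : Fin (N + 1), (MvPolynomial.X j : MvPolynomial (Fin (N + 1)) ℂ) ∉ p.asHomogeneousIdeal := by
  letI := MvPolynomial.gradedAlgebra (σ := Fin (N + 1)) (R := ℂ)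
  by_contra! h
  refine p.not_irrelevant_le ?_
  rw [← toIdeal_le_toIdeal_iff]
  refine le_trans (Motives.Segre.irrelevant_le_span_X (Fin (N + 1)) ℂ) ?_
  rw [Ideal.span_le]
  rintro _ ⟨j, rfl⟩
  exact h j

/-- **BFNP Lemma 49, all large degrees** ("there exists an integer `N` such that, for all
`m ≥ N`, there exists a divisor `D ∈ |𝓛^m|` such that `Z ⊂ D`", for `𝓛 = 𝒪_X(1)`): a
Zariski-closed `Z ⊆ X` missing a point `x` lies, for EVERY degree `k ≥ k₀`, in a hypersurface
section `e⁻¹ V₊(F)` with `deg F = k` not containing `x` — take the form `F₀` of degree `k₀` of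
`exists_form_vanishing_of_notMem` (graded prime avoidance) times `xⱼ^{k - k₀}` for a coordinate
`xⱼ` not vanishing at `e(x)` (`exists_X_notMem_asHomogeneousIdeal`; `𝔭_{e(x)}` is prime).
[cite: BrosnanFangNiePearlstein2009, §6 Lemma 49] -/
theorem exists_forall_le_form_vanishing_of_notMem (e : Motives.ProjectiveEmbedding X)
    {Z : Set X.left} (hZ : IsClosed Z) {x : X.left} (hx : x ∉ Z) :
    ∃ k₀ : ℕ, 0 < k₀ ∧ ∀ k : ℕ, k₀ ≤ k → ∃ F : MvPolynomial (Fin (e.n + 1)) ℂ, F.IsHomogeneous k ∧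
      Z ⊆ e.ι.left.base ⁻¹' (letI := MvPolynomial.gradedAlgebra (σ := Fin (e.n + 1)) (R := ℂ);
        ProjectiveSpectrum.zeroLocus (MvPolynomial.homogeneousSubmodule (Fin (e.n + 1)) ℂ) {F}) ∧
      x ∉ e.ι.left.base ⁻¹' (letI := MvPolynomial.gradedAlgebra (σ := Fin (e.n + 1)) (R := ℂ);
        ProjectiveSpectrum.zeroLocus (MvPolynomial.homogeneousSubmodule (Fin (e.n + 1)) ℂ) {F}) := by
  letI := MvPolynomial.gradedAlgebra (σ := Fin (e.n + 1)) (R := ℂ)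
  obtain ⟨k₀, F, hk₀, hFk, hZF, hxF⟩ := exists_form_vanishing_of_notMem e hZ hx
  obtain ⟨j, hj⟩ := exists_X_notMem_asHomogeneousIdeal
    (e.ι.left.base x : ProjectiveSpectrum (MvPolynomial.homogeneousSubmodule (Fin (e.n + 1)) ℂ))
  refine ⟨k₀, hk₀, fun k hk ↦ ⟨F * MvPolynomial.X j ^ (k - k₀), ?_, fun z hz ↦ ?_, fun hxm ↦ ?_⟩⟩
  · have hmul := hFk.mul ((MvPolynomial.isHomogeneous_X ℂ j).pow (k - k₀))
    rwa [one_mul, Nat.add_sub_cancel' hk] at hmul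
  · -- `F ∈ 𝔭_{e(z)}`, hence `F · xⱼ^{k-k₀} ∈ 𝔭_{e(z)}`
    have hFz : F ∈ ((e.ι.left.base z :
        ProjectiveSpectrum (MvPolynomial.homogeneousSubmodule (Fin (e.n + 1)) ℂ))).asHomogeneousIdeal.toIdeal :=
      HomogeneousIdeal.mem_iff.mpr (Set.singleton_subset_iff.mp (hZF hz))
    have hFz' : F * MvPolynomial.X j ^ (k - k₀) ∈ ((e.ι.left.base z :
        ProjectiveSpectrum (MvPolynomial.homogeneousSubmodule (Fin (e.n + 1)) ℂ))).asHomogeneousIdeal :=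
      HomogeneousIdeal.mem_iff.mp (Ideal.mul_mem_right _ _ hFz)
    exact Set.singleton_subset_iff.mpr hFz'
  · -- `𝔭_{e(x)}` is prime and contains neither `F` nor `xⱼ`
    have hxm' : F * MvPolynomial.X j ^ (k - k₀) ∈ ((e.ι.left.base x :
        ProjectiveSpectrum (MvPolynomial.homogeneousSubmodule (Fin (e.n + 1)) ℂ))).asHomogeneousIdeal.toIdeal :=
      HomogeneousIdeal.mem_iff.mpr (Set.singleton_subset_iff.mp hxm)
    rcases (e.ι.left.base x :
        ProjectiveSpectrum (MvPolynomial.homogeneousSubmodule (Fin (e.n + 1)) ℂ)).isPrime.mem_or_mem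
        hxm' with hF | hXj
    · exact hxF (Set.singleton_subset_iff.mpr (HomogeneousIdeal.mem_iff.mp hF))
    · exact hj (HomogeneousIdeal.mem_iff.mp ((e.ι.left.base x :
        ProjectiveSpectrum (MvPolynomial.homogeneousSubmodule (Fin (e.n + 1)) ℂ)).isPrime.mem_of_pow_mem
          _ hXj))

/-- **The geometric half of BFNP Lemma 50, relative to a support criterion, all large
degrees.** Let `X` be smooth projective over `ℂ`, `n ≥ 1`, `c ∈ H^{2n}(X(ℂ); ℂ)`, and assume the
SUPPORT CRITERION for `c`: whenever `a` is supported on a Zariski-closed `Z` of codimension `≥ n`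
(`a|_{(X ∖ Z)(ℂ)} = 0`) and `c ∪ a ≠ 0`, then `c|_{Z(ℂ)} ≠ 0` ("`ζ ∪ [Zᵢ] ≠ 0` … equivalently
`0 ≠ ζ|_{Zᵢ}`" — supplied from tautness by `map_ne_zero_of_cupProduct_ne_zero_of_taut`, or from
Deligne's Gysin-kernel theorem and the projection formula, file `HodgeSectionRestrictionGysinKernel`).
If `c` pairs non-trivially with some algebraic class `d ∈ Nⁿ H^{2n}(X(ℂ); ℂ)`, then there is
`k₀ ≥ 1` such that for EVERY `k ≥ k₀` some hypersurface section `e⁻¹ V₊(F) ≠ X` with `deg F = k`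
has `c|_{(e⁻¹ V₊(F))(ℂ)} ≠ 0`. Proof (the printed order): the classes pairing to zero with `c` form
a submodule and `Nⁿ H^{2n}` is spanned by the classes `a` killed off closed `Z` of codimension
`≥ n` (`supportedClasses_le`), so `c ∪ a ≠ 0` for one such `a`, `Z` ("for some index `i`"); by the
criterion `c|_{Z(ℂ)} ≠ 0`; `Z` misses a point (`exists_notMem_of_coheight`), so lies in hypersurface
sections `D ≠ X` of every degree `k ≥ k₀` (Lemma 49, `exists_forall_le_form_vanishing_of_notMem`),
and `c|_{D(ℂ)} ≠ 0` by functoriality (`map_ne_zero_of_subset`).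
[cite: BrosnanFangNiePearlstein2009, §6 Lemma 50 and Lemma 49] -/
theorem forall_le_exists_sectionRestriction_ne_zero_of_supportCriterion {m n : ℕ} (hn : 0 < n)
    (hX : Motives.IsSmoothProjective m X) {c : complexBetti X (2 * n)}
    (hcrit : ∀ (Z : Set X.left), IsClosed Z → (∀ z ∈ Z, (n : ℕ∞) ≤ Order.coheight z) →
      ∀ a : complexBetti X (2 * n), complexBetti.restrictCompl X Z (2 * n) a = 0 →
        cupProduct (rfl : 2 * n + 2 * n = 2 * n + 2 * n) c a ≠ 0 →
          singularCohomology.map ℂ ℂ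
            (⟨Subtype.val, continuous_subtype_val⟩ :
              C({P : Motives.ComplexPoints X // P.pt ∈ Z}, Motives.ComplexPoints X)) (2 * n) c ≠ 0)
    (e : Motives.ProjectiveEmbedding X) {d : complexBetti X (2 * n)}
    (hd : d ∈ algebraicClasses X n)
    (hcd : cupProduct (rfl : 2 * n + 2 * n = 2 * n + 2 * n) c d ≠ 0) :
    ∃ k₀ : ℕ, 0 < k₀ ∧ ∀ k : ℕ, k₀ ≤ k →
      ∃ (F : MvPolynomial (Fin (e.n + 1)) ℂ) (Z : Set X.left), F.IsHomogeneous k ∧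
        Z = e.ι.left.base ⁻¹' (letI := MvPolynomial.gradedAlgebra (σ := Fin (e.n + 1)) (R := ℂ);
          ProjectiveSpectrum.zeroLocus (MvPolynomial.homogeneousSubmodule (Fin (e.n + 1)) ℂ) {F}) ∧
        Z ≠ Set.univ ∧
        singularCohomology.map ℂ ℂ
          (⟨Subtype.val, continuous_subtype_val⟩ :
            C({P : Motives.ComplexPoints X // P.pt ∈ Z}, Motives.ComplexPoints X)) (2 * n) c ≠ 0 := by
  classical
  letI := MvPolynomial.gradedAlgebra (σ := Fin (e.n + 1)) (R := ℂ)
  -- "`ζ ∪ [Zᵢ] ≠ 0` for some index `i`": a generator `a` supported on a closed `Z` of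
  -- codimension `≥ n` pairing non-trivially with `c`
  have key : ∃ Z : Set X.left, IsClosed Z ∧ (∀ z ∈ Z, (n : ℕ∞) ≤ Order.coheight z) ∧
      ∃ a : complexBetti X (2 * n), complexBetti.restrictCompl X Z (2 * n) a = 0 ∧
        cupProduct (rfl : 2 * n + 2 * n = 2 * n + 2 * n) c a ≠ 0 := by
    by_contra hall
    push Not at hall
    have hle : algebraicClasses X n ≤
        LinearMap.ker (cupProduct (rfl : 2 * n + 2 * n = 2 * n + 2 * n) c) := by
      refine supportedClasses_le fun Z hZ hcodim ↦ ?_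
      intro a ha
      rw [LinearMap.mem_ker] at ha ⊢
      exact hall Z hZ hcodim a ha
    exact hcd (LinearMap.mem_ker.mp (hle hd))
  obtain ⟨Z, hZ, hcodim, a, ha, hca⟩ := key
  -- "equivalently `0 ≠ ζ|_{Zᵢ}`" (the support criterion)
  have hcZ := hcrit Z hZ hcodim a ha hca
  -- `Zᵢ ⊂ D`, `D ∈ |𝓛^k|` for all `k ≥ k₀` (Lemma 49), and `ζ|_D ≠ 0` by functoriality
  obtain ⟨x, hx⟩ := exists_notMem_of_coheight hX hcodim (Nat.one_le_iff_ne_zero.mpr hn.ne')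
  obtain ⟨k₀, hk₀, hF⟩ := exists_forall_le_form_vanishing_of_notMem e hZ hx
  refine ⟨k₀, hk₀, fun k hk ↦ ?_⟩
  obtain ⟨F, hFk, hZF, hxF⟩ := hF k hk
  exact ⟨F, _, hFk, rfl, fun h ↦ hxF (Set.eq_univ_iff_forall.mp h x), map_ne_zero_of_subset hZF hcZ⟩

/-- **The topological core of BFNP Lemma 50, support form, all large degrees.** As
`forall_le_exists_sectionRestriction_ne_zero_of_supportCriterion`, with the support criterion
supplied by (T) for the SUPPORTS only: every Zariski-closed `Z ⊆ X` all of whose points have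
codimension `≥ n` has `Z(ℂ)` taut in `X(ℂ)` for `H^{2n}(–; ℂ)`
(`map_ne_zero_of_cupProduct_ne_zero_of_taut`). [cite: BrosnanFangNiePearlstein2009, §6 Lemma 50 and Lemma 49] -/
theorem forall_le_exists_sectionRestriction_ne_zero_of_cup_ne_zero {m n : ℕ} (hn : 0 < n)
    (hX : Motives.IsSmoothProjective m X)
    (hTaut : ∀ (Z : Set X.left), IsClosed Z → (∀ z ∈ Z, (n : ℕ∞) ≤ Order.coheight z) →
      ∀ c : complexBetti X (2 * n),
        singularCohomology.map ℂ ℂ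
            (⟨Subtype.val, continuous_subtype_val⟩ :
              C({P : Motives.ComplexPoints X // P.pt ∈ Z}, Motives.ComplexPoints X)) (2 * n) c = 0 →
          ∃ V : Set (Motives.ComplexPoints X), IsOpen V ∧
            (∀ P : Motives.ComplexPoints X, P.pt ∈ Z → P ∈ V) ∧
            singularCohomology.map ℂ ℂ (subsetIncl V) (2 * n) c = 0)
    (e : Motives.ProjectiveEmbedding X) {c d : complexBetti X (2 * n)}
    (hd : d ∈ algebraicClasses X n)
    (hcd : cupProduct (rfl : 2 * n + 2 * n = 2 * n + 2 * n) c d ≠ 0) :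
    ∃ k₀ : ℕ, 0 < k₀ ∧ ∀ k : ℕ, k₀ ≤ k →
      ∃ (F : MvPolynomial (Fin (e.n + 1)) ℂ) (Z : Set X.left), F.IsHomogeneous k ∧
        Z = e.ι.left.base ⁻¹' (letI := MvPolynomial.gradedAlgebra (σ := Fin (e.n + 1)) (R := ℂ);
          ProjectiveSpectrum.zeroLocus (MvPolynomial.homogeneousSubmodule (Fin (e.n + 1)) ℂ) {F}) ∧
        Z ≠ Set.univ ∧
        singularCohomology.map ℂ ℂ
          (⟨Subtype.val, continuous_subtype_val⟩ :
            C({P : Motives.ComplexPoints X // P.pt ∈ Z}, Motives.ComplexPoints X)) (2 * n) c ≠ 0 :=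
  forall_le_exists_sectionRestriction_ne_zero_of_supportCriterion hn hX
    (fun Z hZ hcodim _ ha hca ↦
      map_ne_zero_of_cupProduct_ne_zero_of_taut hZ rfl ha (hTaut Z hZ hcodim c) hca)
    e hd hcd

/-- **BFNP Lemma 50 for one `2n`-fold, support form, in the strength used by Theorem 51**:
granted (P) for `X` and (T) for the Zariski-closed subsets of codimension `≥ n` of `X`, and the
Hodge conjecture for `X`, every non-zero rational `(n, n)`-class `c` has a `k₀ ≥ 1` such that
for every `k ≥ k₀` it restricts non-trivially to some hypersurface section `e⁻¹ V₊(F) ≠ X` with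
`deg F = k` ("there exists an integer `N` such that, for every `m ≥ N`, there exists `p ∈ |𝓛^m|`
such that `ζ|_{𝒳_p} ≠ 0`", proof of Thm. 51 citing Lemma 50).
[cite: BrosnanFangNiePearlstein2009, §6 Lemma 50 and proof of Thm. 51] -/
theorem forall_le_exists_sectionRestriction_ne_zero_of_pairing_of_taut {n : ℕ} (hn : 0 < n)
    (hX : Motives.IsSmoothProjective (2 * n) X) (hHC : HodgeConjectureFor (2 * n) X)
    (hPair : ∀ c : complexBetti X (2 * n), IsRationalClass c →
      IsOfHodgeType (2 * n) X (2 * n) n n c → c ≠ 0 →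
        ∃ a : complexBetti X (2 * n), IsRationalClass a ∧ IsOfHodgeType (2 * n) X (2 * n) n n a ∧
          cupProduct (rfl : 2 * n + 2 * n = 2 * n + 2 * n) c a ≠ 0)
    (hTaut : ∀ (Z : Set X.left), IsClosed Z → (∀ z ∈ Z, (n : ℕ∞) ≤ Order.coheight z) →
      ∀ c : complexBetti X (2 * n),
        singularCohomology.map ℂ ℂ
            (⟨Subtype.val, continuous_subtype_val⟩ :
              C({P : Motives.ComplexPoints X // P.pt ∈ Z}, Motives.ComplexPoints X)) (2 * n) c = 0 →
          ∃ V : Set (Motives.ComplexPoints X), IsOpen V ∧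
            (∀ P : Motives.ComplexPoints X, P.pt ∈ Z → P ∈ V) ∧
            singularCohomology.map ℂ ℂ (subsetIncl V) (2 * n) c = 0)
    (e : Motives.ProjectiveEmbedding X) (c : complexBetti X (2 * n)) (hc : IsRationalClass c)
    (hH : IsOfHodgeType (2 * n) X (2 * n) n n c) (hne : c ≠ 0) :
    ∃ k₀ : ℕ, 0 < k₀ ∧ ∀ k : ℕ, k₀ ≤ k →
      ∃ (F : MvPolynomial (Fin (e.n + 1)) ℂ) (Z : Set X.left), F.IsHomogeneous k ∧
        Z = e.ι.left.base ⁻¹' (letI := MvPolynomial.gradedAlgebra (σ := Fin (e.n + 1)) (R := ℂ);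
          ProjectiveSpectrum.zeroLocus (MvPolynomial.homogeneousSubmodule (Fin (e.n + 1)) ℂ) {F}) ∧
        Z ≠ Set.univ ∧
        singularCohomology.map ℂ ℂ
          (⟨Subtype.val, continuous_subtype_val⟩ :
            C({P : Motives.ComplexPoints X // P.pt ∈ Z}, Motives.ComplexPoints X)) (2 * n) c ≠ 0 := by
  -- (P): a rational `(n, n)`-class `a` with `c ∪ a ≠ 0`; (H): `a` is algebraic
  obtain ⟨a, haQ, haH, hca⟩ := hPair c hc hH hne
  exact forall_le_exists_sectionRestriction_ne_zero_of_cup_ne_zero hn hX hTaut e (hHC.2 n a haQ haH)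
    hca

/-- **The named fact from (P) and (T) for supports only.** Granted, for all smooth projective
complex `2n`-folds (`n ≥ 1`), (P) the non-degeneracy of the cup-product pairing on rational
`(n, n)`-classes and (T) the tautness in `X(ℂ)`, for `H^{2n}(–; ℂ)`, of `Z(ℂ)` for the
Zariski-closed `Z ⊆ X` of codimension `≥ n` (the supports of algebraic classes — the closed
subvarieties `Zᵢ` of the printed proof, not the hypersurface sections), the support form of the
printed proof (`forall_le_exists_sectionRestriction_ne_zero_of_pairing_of_taut`, at `k = k₀`)
yields `hodgeSectionRestriction_of_hodgeConjectureFor`. [cite: BrosnanFangNiePearlstein2009, §6 Lemma 50] -/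
theorem hodgeSectionRestriction_of_hodgeConjectureFor_of_pairing_of_tautSupports
    (hPair : ∀ ⦃n : ℕ⦄ ⦃X : Motives.SchemeOver ℂ⦄, 0 < n → Motives.IsSmoothProjective (2 * n) X →
      ∀ c : complexBetti X (2 * n), IsRationalClass c → IsOfHodgeType (2 * n) X (2 * n) n n c →
        c ≠ 0 → ∃ a : complexBetti X (2 * n), IsRationalClass a ∧
          IsOfHodgeType (2 * n) X (2 * n) n n a ∧
          cupProduct (rfl : 2 * n + 2 * n = 2 * n + 2 * n) c a ≠ 0)
    (hTaut : ∀ ⦃n : ℕ⦄ ⦃X : Motives.SchemeOver ℂ⦄, 0 < n → Motives.IsSmoothProjective (2 * n) X →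
      ∀ (Z : Set X.left), IsClosed Z → (∀ z ∈ Z, (n : ℕ∞) ≤ Order.coheight z) →
        ∀ c : complexBetti X (2 * n),
          singularCohomology.map ℂ ℂ
              (⟨Subtype.val, continuous_subtype_val⟩ :
                C({P : Motives.ComplexPoints X // P.pt ∈ Z}, Motives.ComplexPoints X)) (2 * n) c = 0 →
            ∃ V : Set (Motives.ComplexPoints X), IsOpen V ∧
              (∀ P : Motives.ComplexPoints X, P.pt ∈ Z → P ∈ V) ∧
              singularCohomology.map ℂ ℂ (subsetIncl V) (2 * n) c = 0) :
    hodgeSectionRestriction_of_hodgeConjectureFor := by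
  intro n X hn hX hHC e c hc hH hne
  obtain ⟨k₀, hk₀, hk⟩ := forall_le_exists_sectionRestriction_ne_zero_of_pairing_of_taut hn hX hHC
    (hPair hn hX) (hTaut hn hX) e c hc hH hne
  obtain ⟨F, Z, hFk, hZ, hZu, hcZ⟩ := hk k₀ le_rfl
  exact ⟨k₀, F, Z, hk₀, hFk, hZ, hZu, hcZ⟩

/-- **The named fact from (P) and (LC) for supports only**: as
`hodgeSectionRestriction_of_hodgeConjectureFor_of_pairing_of_tautSupports`, with the tautness
of the supports supplied by `exists_isOpen_map_eq_zero_of_locallyContractibleSpace` from the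
local contractibility of `Z(ℂ)` for the Zariski-closed `Z` of codimension `≥ n` in smooth
projective `2n`-folds (complex algebraic sets are triangulable, hence locally contractible —
the one topological input absent from the tree, here required only for these supports).
[cite: BrosnanFangNiePearlstein2009, §6 Lemma 50] [cite: Spanier1981, Ch. 6 §1, Thm. 10 and Cor. 11] -/
theorem hodgeSectionRestriction_of_hodgeConjectureFor_of_pairing_of_locallyContractibleSupports
    (hPair : ∀ ⦃n : ℕ⦄ ⦃X : Motives.SchemeOver ℂ⦄, 0 < n → Motives.IsSmoothProjective (2 * n) X →
      ∀ c : complexBetti X (2 * n), IsRationalClass c → IsOfHodgeType (2 * n) X (2 * n) n n c →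
        c ≠ 0 → ∃ a : complexBetti X (2 * n), IsRationalClass a ∧
          IsOfHodgeType (2 * n) X (2 * n) n n a ∧
          cupProduct (rfl : 2 * n + 2 * n = 2 * n + 2 * n) c a ≠ 0)
    (hLC : ∀ ⦃n : ℕ⦄ ⦃X : Motives.SchemeOver ℂ⦄, 0 < n → Motives.IsSmoothProjective (2 * n) X →
      ∀ Z : Set X.left, IsClosed Z → (∀ z ∈ Z, (n : ℕ∞) ≤ Order.coheight z) →
        LocallyContractibleSpace {P : Motives.ComplexPoints X // P.pt ∈ Z}) :
    hodgeSectionRestriction_of_hodgeConjectureFor :=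
  hodgeSectionRestriction_of_hodgeConjectureFor_of_pairing_of_tautSupports hPair
    fun _ _ hn hX Z hZ hcodim c hc ↦
      exists_isOpen_map_eq_zero_of_locallyContractibleSpace hX hZ (hLC hn hX Z hZ hcodim) c hc

end HodgeTheory

end Literature.AlgebraicGeometry.HodgeTheory

end
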